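/-
Copyright: the b2b-balaban T⁴-continuum CRUX team, row NE7b OWNER lineage `t4-ne7b-p1` (gen 125). Project licence.
-/
import Summits.QuantumFields.BalabanUV.T4Continuum.Spine.NE7b.SupZdBlockComposition

/-!
# SOFT BLOCK-SPIN STEPS COMPOSE: minimising two soft constraints `a₁Σ_{b ∈ block}(ψ_b − u_b)² + a₂(χ − mean ψ)²` over the intermediate
# field `ψ` on a block of `m` sites gives ONE soft constraint `a′(χ − mean u)²` with `a′ = a₁a₂m∕(a₁m + a₂)`, attained at the explicit
# `ψ* = u + a₂(χ − mean u)∕(a₁m + a₂)`; read on `ℤ^d` with (251)'s composed blocks: for the block means `u = Q′_{n₁}φ` of a fine field and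
# the block `B n₂ c` (`m = (n₂+1)^d`), `min_ψ [a₁Σ_{b ∈ B n₂ c}(ψ_b − (Q′_{n₁}φ)_b)² + a₂(χ_c − (Q′_{n₂}ψ)_c)²] = a′(χ_c − (Q′_Nφ)_c)²`, `N + 1 =
# (n₁+1)(n₂+1)` — two soft steps are one soft step at the composed mesh with the composed coupling, block by block; the analytic
# complement of (251) for § [NE7bP1-G123-HANDOFF] NEXT (3)(c) (row NE7b, node U5c; (251) + `Beta.BlockPoincare` BY NAME; [folklore])

Cell `pub-balaban`, sub-cell `t4`, spine estimate NE7b (`T4WeightBudget.RelWeightBound`; the cell's OWN estimate — NOT PRINTED in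
[Bałaban 1983–89], NOT PROVED).  Crux-route work under `Spine/NE7b/` by the row OWNER (`t4-ne7b-p1` gen 125, file (252)) under FREEZE
(0)'s crux-prover clause; NOTHING of Bałaban's is named as a Lean object, valued or asserted; no `T4Continuum/Support` leaf typed; no `def`,
no notation (`a′` and `ψ*` WRITTEN OUT; the weights of the two levels are absorbed in `a₁, a₂`, so the statements are normalisation-free);
zero `sorry`.  Imports (BY NAME): the OWNER's (251) `…SupZdBlockComposition` (`blockMean_comp`; through it (27) `B6QGQLower276`: `B`,
`chart_mem_B`, `sum_B_const`), the Literature engine `Beta.BlockPoincare` (`avg`, `card_mul_avg_sq_le` = Jensen for the square of a mean),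
Mathlib's `Finset.cast_card`, `field_simp`.

WHY (located).  The road's renormalisation step couples the fine field to the block field SOFTLY (`H_V = (n+1)²(−Δ) + aQ′*Q′ + V` is the
Hessian of `S + ½a|ψ − Q′φ|²`), and (251) recorded the decision path for NEXT (3)(c): (c1) blocks compose (done there), (c2) the soft
steps compose with an explicit coupling law, (c3) the column's constants must then be audited for uniformity in `a ∈ [a_∞, a]`.  (c2) is
elementary and exact: on each `n₂`-block the intermediate minimisation is a quadratic problem in `m + 1` variables whose fluctuation part
(`ψ − u` minus its block mean) only costs, so it reduces to the scalar problem `min_t [a₁mt² + a₂(w − t)²] = a₁a₂m∕(a₁m + a₂)·w²` (complete the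
square); Jensen for the square of a mean (`Beta.BlockPoincare.card_mul_avg_sq_le`) is the only inequality.  The same law governs the
Gaussian convolution of the two block-spin kernels (not typed: no measure here).  Since `a′ = a₁∕(1 + a₂^{−1}a₁m^{… −1})`-type algebra gives
`a₁a₂m∕(a₁m + a₂) ∈ [a₁m∕(m+1)·min(1, a₂∕a₁), a₁]`-type bounds, the composed couplings of `k` equal steps stay in a compact sub-interval of
`(0, a]` — the input of (c3), recorded, not claimed.

WHAT IS PROVED ([folklore]): §1 `scalar_pair_lower`, `scalar_pair_min` (complete the square); §2 **`block_pair_lower`**, **`block_pair_min`**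
(ANY finite nonempty block `s`, `a₁ ≥ 0`, `a₁|s| + a₂ > 0`: the lower bound `a′(χ − avg u)²` for every `ψ` and equality at `ψ*`); §3 READ ON
`ℤ^d`: `card_B_real`, `avg_B`, **`zd_soft_pair_lower`** ∕ **`zd_soft_pair_min`** (the block `B n₂ c`, `m = (n₂+1)^d`, block means written out) and
THE END **`zd_soft_steps_compose`** (with `u = Q′_{n₁}φ`: the minimum over `ψ` of the two soft constraints on the block `B n₂ c` is
`a′(χ_c − (Q′_Nφ)_c)²`, `N + 1 = (n₁+1)(n₂+1)` — lower bound for every `ψ` and the minimiser); §4 toy.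

HONEST (what this is NOT).  Block-by-block algebra of the constraint terms only: the action `S`, the Hessians and the Schur complements are
not touched (for HARD constraints (108)'s semigroup is the statement; for soft ones the full two-step effective action is `min_φ[S(φ) +
Σ_c(this block minimum)]`, by this file equal to the one-step effective action at mesh `N` with coupling `a′` — the assembly over blocks on a
finite torus is a finite sum of §3, on `ℤ^d` it is formal); no Gaussian integral; no `a`-uniformity audit ((c3)); nothing of Bałaban's
asserted.  BY-NAME EFFECT ON THE WALL: NONE.  NE7b NOT PRINTED ∕ NOT PROVED; spine PROVED 0∕9; rung (B)+1 — the programme's measures remain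
FINITE-torus statements; NOT the mass gap, NOT Clay.  HONEST DEPENDENCY: continuum YM on T⁴ ⇐ BetaPertH ∧ nine spine estimates (0∕9
proved); BetaPertH ⇐ (D1) ∧ (D4) ∧ CAP+tail; G-an2-4 gates asym, D1 and NE2∕3∕4.
-/

set_option autoImplicit false

noncomputable section

namespace Summit.QuantumFields.BalabanUV.T4Continuum.NE7b.SupZdSoftStepComposition

open Literature.MathematicalPhysics.QuantumFieldTheory.Balaban1983to89
open B6QGQLower276 (X blk B chart_mem_B sum_B_const)
open Beta.BlockPoincare (avg card_mul_avg_sq_le)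
open SupZdBlockComposition (blockMean_comp)

variable {d : ℕ}

/-! ## §1. The scalar problem: complete the square -/

/-- **COMPLETE THE SQUARE**: `A + a₂ > 0` ⟹ `Aa₂∕(A + a₂)·w² ≤ At² + a₂(w − t)²` for all `t` (the difference is `(A + a₂)(t − a₂w∕(A + a₂))²`).
[folklore] -/
theorem scalar_pair_lower {A a₂ : ℝ} (hpos : 0 < A + a₂) (t w : ℝ) :
    A * a₂ / (A + a₂) * w ^ 2 ≤ A * t ^ 2 + a₂ * (w - t) ^ 2 := by
  have key : A * t ^ 2 + a₂ * (w - t) ^ 2 - A * a₂ / (A + a₂) * w ^ 2 = (A + a₂) * (t - a₂ * w / (A + a₂)) ^ 2 := by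
    field_simp
    ring
  nlinarith [key, mul_nonneg hpos.le (sq_nonneg (t - a₂ * w / (A + a₂)))]

/-- **THE MINIMUM IS ATTAINED** at `t* = a₂w∕(A + a₂)`: `At*² + a₂(w − t*)² = Aa₂∕(A + a₂)·w²`. [folklore] -/
theorem scalar_pair_min {A a₂ : ℝ} (hpos : 0 < A + a₂) (w : ℝ) :
    A * (a₂ * w / (A + a₂)) ^ 2 + a₂ * (w - a₂ * w / (A + a₂)) ^ 2 = A * a₂ / (A + a₂) * w ^ 2 := by
  field_simp
  ring

/-! ## §2. One block: the fluctuation part only costs -/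

/-- **TWO SOFT CONSTRAINTS ON ONE BLOCK, LOWER BOUND**: for a finite nonempty block `s` (`m = |s|`), `a₁ ≥ 0`, `a₁m + a₂ > 0`, fields `u, ψ` on
the block and a coarse value `χ`: `a₁a₂m∕(a₁m + a₂)·(χ − avg u)² ≤ a₁Σ_{b ∈ s}(ψ_b − u_b)² + a₂(χ − avg ψ)²` — Jensen `m·(avg(ψ − u))² ≤ Σ(ψ − u)²`
and §1 with `t = avg(ψ − u)`, `w = χ − avg u`. [folklore] -/
theorem block_pair_lower {ι : Type*} (s : Finset ι) {a₁ a₂ : ℝ} (ha₁ : 0 ≤ a₁) (hpos : 0 < a₁ * s.card + a₂)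
    (u ψ : ι → ℝ) (χ : ℝ) :
    a₁ * s.card * a₂ / (a₁ * s.card + a₂) * (χ - avg s u) ^ 2
      ≤ a₁ * ∑ b ∈ s, (ψ b - u b) ^ 2 + a₂ * (χ - avg s ψ) ^ 2 := by
  have havg : avg s ψ = avg s u + avg s (fun b => ψ b - u b) := by
    unfold avg
    rw [Finset.sum_sub_distrib, sub_div]
    ring
  have hJ : (s.card : ℝ) * avg s (fun b => ψ b - u b) ^ 2 ≤ ∑ b ∈ s, (ψ b - u b) ^ 2 := card_mul_avg_sq_le s _
  have h1 := scalar_pair_lower (A := a₁ * s.card) (a₂ := a₂) hpos (avg s (fun b => ψ b - u b)) (χ - avg s u)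
  have e : χ - avg s ψ = (χ - avg s u) - avg s (fun b => ψ b - u b) := by
    rw [havg]
    ring
  rw [e]
  have h2 : a₁ * s.card * avg s (fun b => ψ b - u b) ^ 2 ≤ a₁ * ∑ b ∈ s, (ψ b - u b) ^ 2 := by
    rw [mul_assoc]
    exact mul_le_mul_of_nonneg_left hJ ha₁
  linarith

/-- **TWO SOFT CONSTRAINTS ON ONE BLOCK, THE MINIMISER**: with `t* = a₂(χ − avg u)∕(a₁m + a₂)` and `ψ*_b = u_b + t*` (nonempty `s`):
`a₁Σ_{b ∈ s}(ψ*_b − u_b)² + a₂(χ − avg ψ*)² = a₁a₂m∕(a₁m + a₂)·(χ − avg u)²`. [folklore] -/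
theorem block_pair_min {ι : Type*} (s : Finset ι) (hs : s.Nonempty) {a₁ a₂ : ℝ} (hpos : 0 < a₁ * s.card + a₂)
    (u : ι → ℝ) (χ : ℝ) :
    a₁ * ∑ b ∈ s, ((u b + a₂ * (χ - avg s u) / (a₁ * s.card + a₂)) - u b) ^ 2
        + a₂ * (χ - avg s (fun b => u b + a₂ * (χ - avg s u) / (a₁ * s.card + a₂))) ^ 2
      = a₁ * s.card * a₂ / (a₁ * s.card + a₂) * (χ - avg s u) ^ 2 := by
  have hcard : (s.card : ℝ) ≠ 0 := by exact_mod_cast hs.card_pos.ne'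
  have havg : avg s (fun b => u b + a₂ * (χ - avg s u) / (a₁ * s.card + a₂))
      = avg s u + a₂ * (χ - avg s u) / (a₁ * s.card + a₂) := by
    unfold avg
    rw [Finset.sum_add_distrib, Finset.sum_const, nsmul_eq_mul, add_div, mul_div_cancel_left₀ _ hcard]
  have hsum : ∑ b ∈ s, ((u b + a₂ * (χ - avg s u) / (a₁ * s.card + a₂)) - u b) ^ 2
      = s.card * (a₂ * (χ - avg s u) / (a₁ * s.card + a₂)) ^ 2 := by
    rw [Finset.sum_congr rfl fun b _ => by rw [add_sub_cancel_left], Finset.sum_const, nsmul_eq_mul]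
  rw [havg, hsum, ← sub_sub, ← mul_assoc]
  exact scalar_pair_min (A := a₁ * s.card) hpos (χ - avg s u)

/-! ## §3. Read on `ℤ^d`: the block `B n₂ c`, block means written out, composed blocks -/

/-- The block has `(n+1)^d` sites (as a real number). [folklore] -/
theorem card_B_real (n : ℕ) (c : X d) : (((B n c).card : ℕ) : ℝ) = ((n : ℝ) + 1) ^ d := by
  rw [Finset.cast_card, sum_B_const, mul_one]

/-- The engine's `avg` on a block is the block mean written out. [folklore] -/
theorem avg_B (n : ℕ) (c : X d) (f : X d → ℝ) : avg (B n c) f = (((n : ℝ) + 1) ^ d)⁻¹ * ∑ b ∈ B n c, f b := by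
  unfold avg
  rw [card_B_real, div_eq_inv_mul]

/-- **TWO SOFT CONSTRAINTS ON THE BLOCK `B n₂ c`, LOWER BOUND** (`m = (n₂+1)^d`, `a₁ ≥ 0`, `a₁m + a₂ > 0`): for all `u, ψ : ℤ^d → ℝ` and `χ`,
`a₁a₂m∕(a₁m + a₂)·(χ c − (n₂+1)^{−d}Σ_{b ∈ B n₂ c}u_b)² ≤ a₁Σ_{b ∈ B n₂ c}(ψ_b − u_b)² + a₂(χ c − (n₂+1)^{−d}Σ_{b ∈ B n₂ c}ψ_b)²`. [folklore] -/
theorem zd_soft_pair_lower (n₂ : ℕ) {a₁ a₂ : ℝ} (ha₁ : 0 ≤ a₁) (hpos : 0 < a₁ * ((n₂ : ℝ) + 1) ^ d + a₂)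
    (u ψ χ : X d → ℝ) (c : X d) :
    a₁ * ((n₂ : ℝ) + 1) ^ d * a₂ / (a₁ * ((n₂ : ℝ) + 1) ^ d + a₂)
        * (χ c - (((n₂ : ℝ) + 1) ^ d)⁻¹ * ∑ b ∈ B n₂ c, u b) ^ 2
      ≤ a₁ * ∑ b ∈ B n₂ c, (ψ b - u b) ^ 2 + a₂ * (χ c - (((n₂ : ℝ) + 1) ^ d)⁻¹ * ∑ b ∈ B n₂ c, ψ b) ^ 2 := by
  have h := block_pair_lower (B n₂ c) (a₂ := a₂) ha₁ (by rw [card_B_real]; exact hpos) u ψ (χ c)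
  rw [card_B_real, avg_B, avg_B] at h
  exact h

/-- **TWO SOFT CONSTRAINTS ON THE BLOCK `B n₂ c`, THE MINIMISER** `ψ*_b = u_b + a₂(χ c − mean u)∕(a₁m + a₂)`: the value is
`a₁a₂m∕(a₁m + a₂)·(χ c − (n₂+1)^{−d}Σ_{b ∈ B n₂ c}u_b)²`. [folklore] -/
theorem zd_soft_pair_min (n₂ : ℕ) {a₁ a₂ : ℝ} (hpos : 0 < a₁ * ((n₂ : ℝ) + 1) ^ d + a₂) (u χ : X d → ℝ) (c : X d) :
    a₁ * ∑ b ∈ B n₂ c, ((u b + a₂ * (χ c - (((n₂ : ℝ) + 1) ^ d)⁻¹ * ∑ b' ∈ B n₂ c, u b')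
        / (a₁ * ((n₂ : ℝ) + 1) ^ d + a₂)) - u b) ^ 2
      + a₂ * (χ c - (((n₂ : ℝ) + 1) ^ d)⁻¹ * ∑ b ∈ B n₂ c,
          (u b + a₂ * (χ c - (((n₂ : ℝ) + 1) ^ d)⁻¹ * ∑ b' ∈ B n₂ c, u b') / (a₁ * ((n₂ : ℝ) + 1) ^ d + a₂))) ^ 2
      = a₁ * ((n₂ : ℝ) + 1) ^ d * a₂ / (a₁ * ((n₂ : ℝ) + 1) ^ d + a₂)
        * (χ c - (((n₂ : ℝ) + 1) ^ d)⁻¹ * ∑ b ∈ B n₂ c, u b) ^ 2 := by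
  have h := block_pair_min (B n₂ c) ⟨_, chart_mem_B n₂ c fun _ => 0⟩ (a₁ := a₁) (a₂ := a₂) (by rw [card_B_real]; exact hpos) u (χ c)
  rw [avg_B, card_B_real, avg_B] at h
  exact h

/-- **THE END — TWO SOFT STEPS ARE ONE SOFT STEP AT THE COMPOSED MESH, BLOCK BY BLOCK**: `N + 1 = (n₁+1)(n₂+1)`, `m = (n₂+1)^d`, `a₁ ≥ 0`,
`a₁m + a₂ > 0`, a fine field `φ`, its `n₁`-block means `u = Q′_{n₁}φ`, a coarse field `χ` and a block label `c`: for EVERY intermediate field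
`ψ`, `a′(χ c − (Q′_Nφ) c)² ≤ a₁Σ_{b ∈ B n₂ c}(ψ_b − (Q′_{n₁}φ)_b)² + a₂(χ c − (Q′_{n₂}ψ) c)²` with `a′ = a₁a₂m∕(a₁m + a₂)`, and equality at `ψ* =
Q′_{n₁}φ + a₂(χ c − (Q′_Nφ) c)∕(a₁m + a₂)` on the block — §3's pair bounds with (251) `blockMean_comp` (`Q′_{n₂}Q′_{n₁} = Q′_N`). [folklore] -/
theorem zd_soft_steps_compose {n₁ n₂ N : ℕ} (hN : N + 1 = (n₁ + 1) * (n₂ + 1)) {a₁ a₂ : ℝ} (ha₁ : 0 ≤ a₁)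
    (hpos : 0 < a₁ * ((n₂ : ℝ) + 1) ^ d + a₂) (φ χ : X d → ℝ) (c : X d) :
    (∀ ψ : X d → ℝ,
      a₁ * ((n₂ : ℝ) + 1) ^ d * a₂ / (a₁ * ((n₂ : ℝ) + 1) ^ d + a₂)
          * (χ c - (((N : ℝ) + 1) ^ d)⁻¹ * ∑ q ∈ B N c, φ q) ^ 2
        ≤ a₁ * ∑ b ∈ B n₂ c, (ψ b - (((n₁ : ℝ) + 1) ^ d)⁻¹ * ∑ q ∈ B n₁ b, φ q) ^ 2
          + a₂ * (χ c - (((n₂ : ℝ) + 1) ^ d)⁻¹ * ∑ b ∈ B n₂ c, ψ b) ^ 2) ∧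
    a₁ * ∑ b ∈ B n₂ c, (((((n₁ : ℝ) + 1) ^ d)⁻¹ * ∑ q ∈ B n₁ b, φ q
          + a₂ * (χ c - (((N : ℝ) + 1) ^ d)⁻¹ * ∑ q ∈ B N c, φ q) / (a₁ * ((n₂ : ℝ) + 1) ^ d + a₂))
          - (((n₁ : ℝ) + 1) ^ d)⁻¹ * ∑ q ∈ B n₁ b, φ q) ^ 2
      + a₂ * (χ c - (((n₂ : ℝ) + 1) ^ d)⁻¹ * ∑ b ∈ B n₂ c,
          ((((n₁ : ℝ) + 1) ^ d)⁻¹ * ∑ q ∈ B n₁ b, φ q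
            + a₂ * (χ c - (((N : ℝ) + 1) ^ d)⁻¹ * ∑ q ∈ B N c, φ q) / (a₁ * ((n₂ : ℝ) + 1) ^ d + a₂))) ^ 2
      = a₁ * ((n₂ : ℝ) + 1) ^ d * a₂ / (a₁ * ((n₂ : ℝ) + 1) ^ d + a₂)
        * (χ c - (((N : ℝ) + 1) ^ d)⁻¹ * ∑ q ∈ B N c, φ q) ^ 2 := by
  have hc : (((N : ℝ) + 1) ^ d)⁻¹ * ∑ q ∈ B N c, φ q
      = (((n₂ : ℝ) + 1) ^ d)⁻¹ * ∑ b ∈ B n₂ c, ((((n₁ : ℝ) + 1) ^ d)⁻¹ * ∑ q ∈ B n₁ b, φ q) := blockMean_comp hN c φ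
  refine ⟨fun ψ => ?_, ?_⟩
  · have h := zd_soft_pair_lower n₂ ha₁ hpos (fun b => (((n₁ : ℝ) + 1) ^ d)⁻¹ * ∑ q ∈ B n₁ b, φ q) ψ χ c
    rw [← hc] at h
    exact h
  · have h := zd_soft_pair_min n₂ hpos (fun b => (((n₁ : ℝ) + 1) ^ d)⁻¹ * ∑ q ∈ B n₁ b, φ q) χ c
    rw [← hc] at h
    exact h

/-! ## §4. Toy -/

/-- Toy: one site (`m = 1`), `a₁ = a₂ = 1` ⟹ `a′ = ½`; indeed `min_t [t² + (w − t)²] = ½w²` at `t = w∕2`. -/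
example (w : ℝ) : (1 : ℝ) * (1 * w / (1 + 1)) ^ 2 + 1 * (w - 1 * w / (1 + 1)) ^ 2 = 1 * 1 / (1 + 1) * w ^ 2 :=
  scalar_pair_min (A := 1) (a₂ := 1) (by norm_num) w

end Summit.QuantumFields.BalabanUV.T4Continuum.NE7b.SupZdSoftStepComposition
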